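import Summits.HodgeConjecture.HodgeConjecture.Theorems.Ring2MotivProductCMFactorDischarged
import Literature.AlgebraicGeometry.HodgeTheory.TotallyRealMaxSubfieldPowersHodgeClasses
import HarnessLib

/-!
# Ring 2 · route `motiv` (generation 111) — the MURTY-TYPE PRODUCT CELLS at half-rank `m = 1`, BOTH print binders gone: `(B ~ A^{N+1}, A with a Murty packet (K, φ, 1), B without type-IV factor) × (C of CM type)`

HONEST FRAMING (cell `pub-hodge-ring2`): research route conditional on HC_CM; not a corollary;
Q11.4-sentence-2 already refuted in dim ≥ 3. No transport is used here.

This is route `motiv`'s ONE downstream file on the word of RULING F-LEAD-87-1 (b) (2026-08-22T10:55Z): NEW theorem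
names, no edit of `Ring2MotivMurtyTypeCells` / `Ring2MotivProductCMFactorDischarged` (their `hM` displays stand as
typed for every odd `m`), and exactly the `m = 1` SPECIALISATION of that lane's Murty-bound rows with the binder
`hM : Murty1988_hodgeClasses_divisorial_powers_totallyRealMaxSubfield_oddHalfRank` DISCHARGED by the Literature
lane's tree theorems of 2026-08-22 (programme R6, `HodgeTheory/TotallyRealMaxSubfieldPowersHodgeClasses`,
p326229): `hodgeConjectureFor_powSucc_of_isMurtyTypeWith_one : IsMurtyTypeWith A K φ 1 → ∀ N, HC(A^{N+1})` and
`hodgeConjectureFor_of_isIsogenous_powSucc_of_isMurtyTypeWith_one` (V. K. Murty 1988 Thm. 2, CASE `m = 1`: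
`K ⊂ End⁰(A)` a totally real self-commutant subfield with `[K:ℚ] = dim A`; a special case of Hazama 1983). The
Lombardo binder `hL` was already discharged (`NoTypeIVTimesCMProductSpan`, `Lombardo2016_hodgeClassesProductSpan_holds`,
used through `Ring2MotivProductCMFactorDischarged`). The all-odd-`m` constant is NOT proved by any of this and is
not used below; the `m ≥ 3` rows of the lane stay bound to it.

LEFT CLASS of this file (the `m = 1` sub-class of `Ring2MotivMurtyTypeCells`' `𝒜_Mu`, see `§0`):

  `𝒜_Mu₁ B := (∃ A K φ N, IsMurtyTypeWith A K φ 1 ∧ B ~ A^{N+1}) ∧ HasNoTypeIVFactor B`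

— the isogeny-closed class of powers of abelian varieties carrying a Murty packet of half-rank one (in the atlas,
`g ≤ 7`: powers of type-II(g/2) abelian varieties in even dimension `g`, e.g. QM abelian surfaces; simple sixfolds of
type II(3) = row `g6.II(3)`; type I with `End⁰ = ` a totally real field of degree `dim A`), with the cell's splitting
hypothesis `HasNoTypeIVFactor` KEPT EXPLICIT exactly as in the lane (in print it is automatic; not a tree theorem).
Rows — each ONE instance of a `Ring2MotivProductCells` / `…CMFactorDischarged` row with HC on `𝒜_Mu₁` now a THEOREM:
* §0 HC on the left class `𝒜_Mu₁`: UNCONDITIONAL (no fact, no `HC_CM`); and `𝒜_Mu₁ ⊆ 𝒜_Mu`.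
* §1 KIND = LOAD-BEARING (route P): `HC_CM → HC(ProdCMCell 𝒜_Mu₁ 𝒞)` for every `𝒞` — `HC_CM`
  (`Theses.RankFourFaces.CMAbelianHodge`, item stmt-HodgeConjecture-3052, a HYPOTHESIS by name) is now the ONLY
  binder, used once per member, at the CM factor; plus the strict-product spelling `HC_CM → HC((A^{N+1}) × C)`.
* §2 KIND = ABSENT — UNCONDITIONAL kernel theorems (no binder at all): `HC(ProdCMCell 𝒜_Mu₁ (dim ≤ 3))`,
  `HC(ProdCMCell 𝒜_Mu₁ IsDivisorGenerated)`, and the strict spelling `HC((A^{N+1}) × C)` for `C` CM of `dim ≤ 3`.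
* §3 EXACTNESS, UNCONDITIONAL: on the full cell (`𝒞 = ⊤`, one member on each side)
  `HC(ProdCMCell 𝒜_Mu₁ ⊤) ↔ HC_CM` — the left class now costs NOTHING, the CM side costs all of `HC_CM`; also in the
  kernel's class-target currency `HCOnClass`.
* §4 ON PATH: every cell from `HC_AV` (item stmt-HodgeConjecture-1333) and from the summit statement (bookkeeping).
PRINT STATUS of every row: KNOWN modulo `HC_CM` where `HC_CM` appears, KNOWN outright where it does not (Murty 1988
Thm. 2 with Moonen–Zarhin 1999 (3.1) / Lombardo 2016 Lemma 3.4); TREE STATUS after this file: the `m = 1` Murty-type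
product rows are kernel theorems with `HC_CM` as the only hypothesis (§1) or none (§2, §3's equivalence), where the
lane's generation-46/103 rows carried `hM` (and `hL`). Nothing here is summit progress: §3 says these cells are worth
exactly `HC_CM`, and §4 that they lie on the summit's path.

THEOREMS ONLY; no `def`, no named fact, no `sorry`. References (bib keys): Murty1988 (Thm. 2, §1 Remark 1, p. 66),
Hazama1983 (Thm. (1.1)), Lombardo2016 (Lemma 3.4), MoonenZarhin1999LowDim (§3 (3.1)), Milne1999 (§7 (H)),
Deligne2000 (§1), Fulton1998 (Example 10.1.2), vanGeemen1994HodgeAV (Lemma 3.7).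
-/

set_option linter.dupNamespace false

namespace Summit.HodgeConjecture.HodgeConjecture.Ring2.Motiv

open CategoryTheory
open Literature.AlgebraicGeometry Literature.AlgebraicGeometry.Motives
open Literature.AlgebraicGeometry.HodgeTheory
open Literature.AlgebraicGeometry.Milne1999
open Summit.HodgeConjecture.HodgeConjecture.Theses
open Summit.HodgeConjecture.HodgeConjecture.Ring2.ClassTargets

variable {𝒞 : AbelianVariety ℂ → Prop}

/-! ## §0 HC on the left class `𝒜_Mu₁` — UNCONDITIONAL (Murty 1988 Thm. 2, `m = 1`, a tree theorem) -/

/-- **HC on the half-rank-one Murty-type power class, UNCONDITIONAL**: every `B ~ A^{N+1}` with `A` carrying a Murty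
packet `(K, φ, 1)` satisfies the Hodge conjecture — the Literature theorem
`hodgeConjectureFor_of_isIsogenous_powSucc_of_isMurtyTypeWith_one` (powers: Murty's Thm. 2 at `m = 1`, proved in the
tree; the isogeny: van Geemen's Lemma 3.7). No fact binder, no `HC_CM`. The conjunct `HasNoTypeIVFactor B` is not used
here — it is the splitting hypothesis of the product rows below. This is the `m = 1` case of
`hodgeConjectureFor_of_murtyTypePow_noTypeIV_of_murty1988` WITHOUT `hM`.
[cite: Murty1988, Thm. 2 and §1 Remark 1] [cite: Hazama1983, Thm. (1.1)] [cite: vanGeemen1994HodgeAV, Lemma 3.7] -/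
theorem hodgeConjectureFor_of_murtyTypeOnePow_noTypeIV (B : AbelianVariety ℂ)
    (hB : (∃ (A : AbelianVariety ℂ) (K : Type) (_ : Field K) (_ : NumberField K) (φ : K →+* A.endAlgebra) (N : ℕ),
      IsMurtyTypeWith A K φ 1 ∧ AbelianVariety.IsIsogenous B (A.powSucc N)) ∧ HasNoTypeIVFactor B) :
    HodgeConjectureFor B.dim B.X := by
  obtain ⟨A, K, _, _, φ, N, hA, hBi⟩ := hB.1
  exact hodgeConjectureFor_of_isIsogenous_powSucc_of_isMurtyTypeWith_one hA hBi

/-- **`𝒜_Mu₁ ⊆ 𝒜_Mu`**: the half-rank-one class lies in the lane's all-odd-`m` class `HasTotallyRealOddMaxSubfield`-powers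
of `Ring2MotivMurtyTypeCells` (so every row there specialises to the rows here; there modulo `hM`, here not).
[cite: Murty1988, Thm. 2] -/
theorem murtyTypePow_noTypeIV_of_murtyTypeOnePow_noTypeIV (B : AbelianVariety ℂ)
    (hB : (∃ (A : AbelianVariety ℂ) (K : Type) (_ : Field K) (_ : NumberField K) (φ : K →+* A.endAlgebra) (N : ℕ),
      IsMurtyTypeWith A K φ 1 ∧ AbelianVariety.IsIsogenous B (A.powSucc N)) ∧ HasNoTypeIVFactor B) :
    (∃ (A : AbelianVariety ℂ) (N : ℕ), HasTotallyRealOddMaxSubfield A ∧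
      AbelianVariety.IsIsogenous B (A.powSucc N)) ∧ HasNoTypeIVFactor B := by
  obtain ⟨A, K, _, _, φ, N, hA, hBi⟩ := hB.1
  exact ⟨⟨A, N, hasTotallyRealOddMaxSubfield_of_isMurtyTypeWith hA, hBi⟩, hB.2⟩

/-! ## §1 KIND = LOAD-BEARING (route P): arbitrary CM factor, `HC_CM` the only binder -/

/-- **ROW (route P): HC on the half-rank-one Murty-type product cells from `HC_CM` alone.** For every `X ~ B × C` with
`B ~ A^{N+1}`, `A` carrying a Murty packet `(K, φ, 1)`, `B` without type-IV factor, and `C` of CM type (any dimension,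
any `𝒞`): the Hodge conjecture holds for `X`, from `HC_CM` (binder `hCM`, item stmt-HodgeConjecture-3052 by name, used
once — at `C`). Lombardo's span fact and Murty's theorem are tree theorems here. The `m = 1` case of
`hodgeConjectureFor_of_prodCMCell_murtyTypePow_noTypeIV_of_cmAbelianHodge` without `hL`, `hM`.
[cite: Murty1988, Thm. 2] [cite: Lombardo2016, Lemma 3.4 (p. 1229)] [cite: Milne1999, §7 (H)] -/
theorem hodgeConjectureFor_of_prodCMCell_murtyTypeOnePow_noTypeIV_of_cmAbelianHodge
    (hCM : RankFourFaces.CMAbelianHodge) {X : AbelianVariety ℂ}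
    (hX : ProdCMCell (fun B ↦ (∃ (A : AbelianVariety ℂ) (K : Type) (_ : Field K) (_ : NumberField K)
      (φ : K →+* A.endAlgebra) (N : ℕ), IsMurtyTypeWith A K φ 1 ∧ AbelianVariety.IsIsogenous B (A.powSucc N)) ∧
      HasNoTypeIVFactor B) 𝒞 X) :
    HodgeConjectureFor X.dim X.X :=
  hodgeConjectureFor_of_prodCMCell_noTypeIV_of_cmAbelianHodge hCM
    (fun B hB ↦ hodgeConjectureFor_of_murtyTypeOnePow_noTypeIV B hB) hX

/-- **The strict-product spelling on a half-rank-one Murty packet**: for `IsMurtyTypeWith A K φ 1`, every `N`, every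
CM `C`, `HC_CM → HasNoTypeIVFactor (A^{N+1}) → HC(A^{N+1} × C)` — Part I's frame
`hodgeConjectureFor_prod_of_cmHodgeHypothesis` with the span fact a tree theorem and HC of the left factor the tree's
`hodgeConjectureFor_powSucc_of_isMurtyTypeWith_one`. `HC_CM` unfolds to Milne's per-variety form by `Iff.rfl`.
[cite: Murty1988, Thm. 2] [cite: Lombardo2016, Lemma 3.4 (p. 1229)] [cite: Milne1999, §7 (H)] -/
theorem hodgeConjectureFor_powSucc_prod_of_isMurtyTypeWithOne_of_cmAbelianHodge
    (hCM : RankFourFaces.CMAbelianHodge)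
    {K : Type} [Field K] [NumberField K] {A : AbelianVariety ℂ} {φ : K →+* A.endAlgebra}
    (hA : IsMurtyTypeWith A K φ 1) (N : ℕ) (h4 : HasNoTypeIVFactor (A.powSucc N))
    (C : AbelianVariety ℂ) (hCt : IsOfCMType C) :
    HodgeConjectureFor ((A.powSucc N).prod C).dim ((A.powSucc N).prod C).X :=
  hodgeConjectureFor_prod_of_cmHodgeHypothesis (fun B ↦ hCM B) Lombardo2016_hodgeClassesProductSpan_holds
    (A.powSucc N) C h4 hCt (hodgeConjectureFor_powSucc_of_isMurtyTypeWith_one hA N)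

/-! ## §2 KIND = ABSENT — UNCONDITIONAL rows (no binder at all) -/

/-- **ROW, UNCONDITIONAL: CM factor of dimension `≤ 3`.** Every `X ~ B × C` with `B` in the half-rank-one Murty-type
power class without type-IV factor and `C` of CM type of dimension `≤ 3` satisfies the Hodge conjecture — HC of the CM
factor is the tree's unconditional `dim ≤ 3` theorem, the span is Lombardo's (tree theorem), the left factor is
Murty's `m = 1` (tree theorem). The `m = 1` case of
`hodgeConjectureFor_of_prodCMCell_murtyTypePow_noTypeIV_cm_dim_le_three_of_lombardo` with NO binder.
[cite: Murty1988, Thm. 2] [cite: Lombardo2016, Lemma 3.4 (p. 1229)] [cite: MoonenZarhin1999LowDim, Introduction and §3] -/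
theorem hodgeConjectureFor_of_prodCMCell_murtyTypeOnePow_noTypeIV_cm_dim_le_three {X : AbelianVariety ℂ}
    (hX : ProdCMCell (fun B ↦ (∃ (A : AbelianVariety ℂ) (K : Type) (_ : Field K) (_ : NumberField K)
      (φ : K →+* A.endAlgebra) (N : ℕ), IsMurtyTypeWith A K φ 1 ∧ AbelianVariety.IsIsogenous B (A.powSucc N)) ∧
      HasNoTypeIVFactor B) (fun C ↦ C.dim ≤ 3) X) :
    HodgeConjectureFor X.dim X.X :=
  hodgeConjectureFor_of_prodCMCell_noTypeIV_cm_dim_le_three_of_lombardo Lombardo2016_hodgeClassesProductSpan_holds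
    (fun B hB ↦ hodgeConjectureFor_of_murtyTypeOnePow_noTypeIV B hB) hX

/-- **ROW, UNCONDITIONAL: CM factor with divisor-generated Hodge ring** (e.g. a power of a CM elliptic curve, a simple
CM abelian variety of prime dimension). The `m = 1` case of
`hodgeConjectureFor_of_prodCMCell_murtyTypePow_noTypeIV_cmDivisorGenerated_of_lombardo` with NO binder.
[cite: Murty1988, Thm. 2] [cite: Lombardo2016, Lemma 3.4 (p. 1229)] [cite: vanGeemen1994HodgeAV, Thm. 4.6] -/
theorem hodgeConjectureFor_of_prodCMCell_murtyTypeOnePow_noTypeIV_cmDivisorGenerated {X : AbelianVariety ℂ}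
    (hX : ProdCMCell (fun B ↦ (∃ (A : AbelianVariety ℂ) (K : Type) (_ : Field K) (_ : NumberField K)
      (φ : K →+* A.endAlgebra) (N : ℕ), IsMurtyTypeWith A K φ 1 ∧ AbelianVariety.IsIsogenous B (A.powSucc N)) ∧
      HasNoTypeIVFactor B) IsDivisorGenerated X) :
    HodgeConjectureFor X.dim X.X :=
  hodgeConjectureFor_of_prodCMCell_isDivisorGenerated (cellProductSpan_of_hasNoTypeIVFactor fun _ hB ↦ hB.2)
    (fun B hB ↦ hodgeConjectureFor_of_murtyTypeOnePow_noTypeIV B hB) hX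

/-- **The strict-product spelling, UNCONDITIONAL**: for `IsMurtyTypeWith A K φ 1`, every `N` with `A^{N+1}` free of
type-IV factors, and every CM `C` of dimension `≤ 3`: `HC(A^{N+1} × C)`, no hypothesis beyond the data.
[cite: Murty1988, Thm. 2] [cite: Lombardo2016, Lemma 3.4 (p. 1229)] [cite: MoonenZarhin1999LowDim, §3 (3.1)] -/
theorem hodgeConjectureFor_powSucc_prod_of_isMurtyTypeWithOne_cm_dim_le_three
    {K : Type} [Field K] [NumberField K] {A : AbelianVariety ℂ} {φ : K →+* A.endAlgebra}
    (hA : IsMurtyTypeWith A K φ 1) (N : ℕ) (h4 : HasNoTypeIVFactor (A.powSucc N))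
    (C : AbelianVariety ℂ) (hCt : IsOfCMType C) (hC3 : C.dim ≤ 3) :
    HodgeConjectureFor ((A.powSucc N).prod C).dim ((A.powSucc N).prod C).X :=
  hodgeConjectureFor_of_prodCMCell_murtyTypeOnePow_noTypeIV_cm_dim_le_three
    (prodCMCell_prod (𝒞 := fun C ↦ C.dim ≤ 3)
      ⟨⟨A, K, inferInstance, inferInstance, φ, N, hA, AbelianVariety.IsIsogenous.refl _⟩, h4⟩ hCt hC3)

/-! ## §3 EXACTNESS, UNCONDITIONAL: the full half-rank-one Murty-type product cell is worth exactly `HC_CM` -/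

/-- **EXACTNESS (no binder).** On the full cell (`𝒞 = ⊤`), given one member of the left class and one CM abelian
variety, HC on the half-rank-one Murty-type product cells is EQUIVALENT to `HC_CM`: the left class costs nothing
(§0), the CM side costs all of `HC_CM` (descent to the right factor, Part II `hodgeConjectureFor_right_of_prod`).
The `m = 1` case of `forall_prodCMCell_murtyTypePow_noTypeIV_top_iff_cmAbelianHodge_of_murty1988` WITHOUT `hM`.
[cite: Murty1988, Thm. 2] [cite: Lombardo2016, Lemma 3.4 (p. 1229)] [cite: Milne1999, §7 (H)]
[cite: Fulton1998, §10.1 Example 10.1.2] -/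
theorem forall_prodCMCell_murtyTypeOnePow_noTypeIV_top_iff_cmAbelianHodge
    (hA₀ : ∃ B : AbelianVariety ℂ, (∃ (A : AbelianVariety ℂ) (K : Type) (_ : Field K) (_ : NumberField K)
      (φ : K →+* A.endAlgebra) (N : ℕ), IsMurtyTypeWith A K φ 1 ∧ AbelianVariety.IsIsogenous B (A.powSucc N)) ∧
      HasNoTypeIVFactor B)
    (hC₀ : ∃ C : AbelianVariety ℂ, IsOfCMType C) :
    (∀ X : AbelianVariety ℂ,
        ProdCMCell (fun B ↦ (∃ (A : AbelianVariety ℂ) (K : Type) (_ : Field K) (_ : NumberField K)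
          (φ : K →+* A.endAlgebra) (N : ℕ), IsMurtyTypeWith A K φ 1 ∧ AbelianVariety.IsIsogenous B (A.powSucc N)) ∧
          HasNoTypeIVFactor B) (fun _ ↦ True) X →
        HodgeConjectureFor X.dim X.X) ↔ RankFourFaces.CMAbelianHodge := by
  rw [forall_prodCMCell_noTypeIV_top_iff_of_lombardo
    (𝒜 := fun B ↦ ∃ (A : AbelianVariety ℂ) (K : Type) (_ : Field K) (_ : NumberField K)
      (φ : K →+* A.endAlgebra) (N : ℕ), IsMurtyTypeWith A K φ 1 ∧ AbelianVariety.IsIsogenous B (A.powSucc N))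
    Lombardo2016_hodgeClassesProductSpan_holds hA₀ hC₀]
  exact ⟨fun h ↦ h.2, fun h ↦ ⟨fun B hB ↦ hodgeConjectureFor_of_murtyTypeOnePow_noTypeIV B hB, h⟩⟩

/-- **EXACTNESS in the class-target currency (no binder)**: `HCOnClass (ProdCMCell 𝒜_Mu₁ ⊤) ↔ HC_CM`, given one member
on each side. [cite: Lombardo2016, Lemma 3.4 (p. 1229)] [cite: Milne1999, §7 p. 72] [cite: Fulton1998, §10.1 Example 10.1.2] -/
theorem hcOnClass_prodCMCell_murtyTypeOnePow_noTypeIV_top_iff_cmAbelianHodge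
    (hA₀ : ∃ B : AbelianVariety ℂ, (∃ (A : AbelianVariety ℂ) (K : Type) (_ : Field K) (_ : NumberField K)
      (φ : K →+* A.endAlgebra) (N : ℕ), IsMurtyTypeWith A K φ 1 ∧ AbelianVariety.IsIsogenous B (A.powSucc N)) ∧
      HasNoTypeIVFactor B)
    (hC₀ : ∃ C : AbelianVariety ℂ, IsOfCMType C) :
    HCOnClass (ProdCMCell (fun B ↦ (∃ (A : AbelianVariety ℂ) (K : Type) (_ : Field K) (_ : NumberField K)
        (φ : K →+* A.endAlgebra) (N : ℕ), IsMurtyTypeWith A K φ 1 ∧ AbelianVariety.IsIsogenous B (A.powSucc N)) ∧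
        HasNoTypeIVFactor B) fun _ ↦ True) ↔ RankFourFaces.CMAbelianHodge := by
  rw [hcOnClass_prodCMCell_noTypeIV_top_iff
    (𝒜 := fun B ↦ ∃ (A : AbelianVariety ℂ) (K : Type) (_ : Field K) (_ : NumberField K)
      (φ : K →+* A.endAlgebra) (N : ℕ), IsMurtyTypeWith A K φ 1 ∧ AbelianVariety.IsIsogenous B (A.powSucc N))
    hA₀ hC₀]
  exact ⟨fun h ↦ h.2, fun h ↦ ⟨fun B hB ↦ hodgeConjectureFor_of_murtyTypeOnePow_noTypeIV B hB, h⟩⟩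

/-- **The left class as a class target, UNCONDITIONAL**: `HCOnClass 𝒜_Mu₁` holds outright (§0 in the kernel's
currency). [cite: Murty1988, Thm. 2 (p. 67)] [cite: vanGeemen1994HodgeAV, Lemma 3.7] -/
theorem hcOnClass_murtyTypeOnePow_noTypeIV :
    HCOnClass fun B ↦ (∃ (A : AbelianVariety ℂ) (K : Type) (_ : Field K) (_ : NumberField K)
      (φ : K →+* A.endAlgebra) (N : ℕ), IsMurtyTypeWith A K φ 1 ∧ AbelianVariety.IsIsogenous B (A.powSucc N)) ∧
      HasNoTypeIVFactor B :=
  fun B hB ↦ hodgeConjectureFor_of_murtyTypeOnePow_noTypeIV B hB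

/-! ## §4 ON PATH (mandatory, free) -/

/-- **ON-PATH: `HC_AV → HC(cell)`** (item stmt-HodgeConjecture-1333 by name). [cite: Deligne2000, §1] -/
theorem hodgeConjectureFor_of_prodCMCell_murtyTypeOnePow_of_hodgeAbelianVarieties
    (h : PadicSemiregularLift.HodgeAbelianVarieties) {X : AbelianVariety ℂ}
    (hX : ProdCMCell (fun B ↦ (∃ (A : AbelianVariety ℂ) (K : Type) (_ : Field K) (_ : NumberField K)
      (φ : K →+* A.endAlgebra) (N : ℕ), IsMurtyTypeWith A K φ 1 ∧ AbelianVariety.IsIsogenous B (A.powSucc N)) ∧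
      HasNoTypeIVFactor B) 𝒞 X) :
    HodgeConjectureFor X.dim X.X :=
  hodgeConjectureFor_of_prodCMCell_of_hodgeAbelianVarieties h hX

/-- **ON-PATH: the summit statement `HodgeConjecture → HC(cell) ∧ HC_CM`** — the summit gives the conclusion of every
row above AND the hypothesis `HC_CM` of §1, so no row is beside the path and §3 claims nothing beyond it on either
side. [cite: Deligne2000, §1] -/
theorem hodgeConjectureFor_of_prodCMCell_murtyTypeOnePow_of_hodgeConjecture
    (h : _root_.HodgeConjecture) {X : AbelianVariety ℂ}
    (hX : ProdCMCell (fun B ↦ (∃ (A : AbelianVariety ℂ) (K : Type) (_ : Field K) (_ : NumberField K)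
      (φ : K →+* A.endAlgebra) (N : ℕ), IsMurtyTypeWith A K φ 1 ∧ AbelianVariety.IsIsogenous B (A.powSucc N)) ∧
      HasNoTypeIVFactor B) 𝒞 X) :
    HodgeConjectureFor X.dim X.X ∧ RankFourFaces.CMAbelianHodge :=
  ⟨hodgeConjectureFor_of_prodCMCell_of_hodgeConjecture h hX, cmAbelianHodge_of_hodgeConjecture h⟩

end Summit.HodgeConjecture.HodgeConjecture.Ring2.Motiv
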